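import Summits.AtomisticToContinuum.BoseEinsteinCondensation.Theses.BECConjugateDomination
import Literature.MathematicalPhysics.QuantumManyBody.PeriodizedPotentialNearestImage
import Literature.MathematicalPhysics.QuantumManyBody.PeriodicBoseGasImpurity
import Literature.MathematicalPhysics.QuantumManyBody.PeriodicBoseGasRelabelling
import Literature.MathematicalPhysics.QuantumManyBody.LeeNoBindingTorus
import Mathlib.Analysis.SpecialFunctions.SmoothTransition
import Mathlib.Analysis.InnerProductSpace.Laplacian

/-!
# Route `BECConjugateDomination`, crux `PuffFloor` (stmt-AtomisticToContinuum-11785),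
# line `coupling-slope-pocket`, stub S7in `stub_innerPairCount` — the smearing kernel

Supports (does not close) stmt-AtomisticToContinuum-11785. Tools for the lead's glue stub S7in of skeleton v6
(`Cruxes/PuffFloor/Lines/coupling_slope_pocket.lean`):

* `exists_flatTop_profile` — a radial flat-top bump profile `h` (`= 1` on `[0, δ/2]`, `= 0` beyond `δ`,
  values in `[0,1]`, `x ↦ h(|x|)` of class `C²`), built from `Real.smoothTransition` applied to `δ² − |x|²`;
* the **smearing kernel** `k = (w^per)ᵗᵒᴿᵉᵃˡ`, `w = ofReal ∘ h`: `C²` (`kernel_contDiff`), `Lℤ³`-periodic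
  (`kernel_periodic`), `0 ≤ k ≤ 1` (`kernel_nonneg`, `kernel_le_one`), flat-topped on every lattice image
  (`kernel_flatTop`), supported within `δ` of the lattice images (`kernel_support`), with `k, Dk, D²k` bounded
  (`kernel_bounds`), and `Δ(k(· − y)) = (Δk)(· − y)` (`laplacian_comp_sub`);
* **pair relabelling**: `∫ F(xᵢ − xⱼ)|Ψ|² = ∫ F(x₀ − x₁)|Ψ|²` for a Bose-symmetric periodic state
  (`lintegral_pair_eq_pair01`, from `setLIntegral_cellN_comp_perm`).

References: LSSY2005 Ch. 2 (periodised potentials, nearest image); folklore.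
-/

noncomputable section

namespace Summit.AtomisticToContinuum.BoseEinsteinCondensation.Theorems

open MeasureTheory Filter Metric
open scoped ENNReal NNReal BigOperators Laplacian Topology
open Literature.MathematicalPhysics.QuantumManyBody.BoseGas

namespace PuffFloorInnerPairCount

/-! ## A flat-top radial bump -/

/-- **Flat-top radial bump.** For `δ > 0` there is a profile `h : ℝ → [0,1]` with `h(r) = 1` for `|r| ≤ δ/2`,
`h(r) = 0` for `|r| ≥ δ`, such that `x ↦ h(|x|)` is `C²` on `ℝ³` (indeed smooth: `smoothTransition` of an affine
function of `|x|²`). [folklore] -/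
theorem exists_flatTop_profile {δ : ℝ} (hδ : 0 < δ) :
    ∃ h : ℝ → ℝ, ContDiff ℝ 2 (fun x : Space => h ‖x‖) ∧ (∀ r, 0 ≤ h r) ∧ (∀ r, h r ≤ 1) ∧
      (∀ r, |r| ≤ δ / 2 → h r = 1) ∧ (∀ r, δ ≤ |r| → h r = 0) := by
  have hc : 0 < 3 / 4 * δ ^ 2 := by positivity
  refine ⟨fun r => Real.smoothTransition ((δ ^ 2 - r ^ 2) / (3 / 4 * δ ^ 2)), ?_,
    fun r => Real.smoothTransition.nonneg _, fun r => Real.smoothTransition.le_one _, ?_, ?_⟩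
  · have h1 : ContDiff ℝ 2 (fun x : Space => (δ ^ 2 - ‖x‖ ^ 2) / (3 / 4 * δ ^ 2)) :=
      (contDiff_const.sub (contDiff_norm_sq ℝ)).div_const _
    exact Real.smoothTransition.contDiff.comp h1
  · intro r hr
    apply Real.smoothTransition.one_of_one_le
    rw [le_div_iff₀ hc]
    have : r ^ 2 ≤ (δ / 2) ^ 2 := by
      rw [← sq_abs r]
      exact pow_le_pow_left₀ (abs_nonneg r) hr 2
    nlinarith
  · intro r hr
    apply Real.smoothTransition.zero_of_nonpos
    rw [div_nonpos_iff]
    right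
    refine ⟨?_, hc.le⟩
    have : δ ^ 2 ≤ r ^ 2 := by
      rw [← sq_abs r]
      exact pow_le_pow_left₀ hδ.le hr 2
    linarith

/-! ## The smearing kernel `k = (w^per).toReal`, `w = ofReal ∘ h` -/

section Kernel

variable {L δ : ℝ} {h : ℝ → ℝ}

/-- The `ℝ≥0∞` profile of the bump has range `δ`. [folklore] -/
theorem profile_range (hsupp : ∀ r, δ ≤ |r| → h r = 0) :
    ∀ r, δ < r → ENNReal.ofReal (h r) = 0 := fun r hr => by
  rw [hsupp r (hr.le.trans (le_abs_self r)), ENNReal.ofReal_zero]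

/-- The kernel is `C²` (locally a single smooth translate, `contDiff_toReal_periodizedPotential`). [folklore] -/
theorem kernel_contDiff (hL : 0 < L) (hδL : 2 * δ < L)
    (hh : ContDiff ℝ 2 (fun x : Space => h ‖x‖)) (h0 : ∀ r, 0 ≤ h r) (hsupp : ∀ r, δ ≤ |r| → h r = 0) :
    ContDiff ℝ 2 (fun z : Space => (periodizedPotential (fun r => ENNReal.ofReal (h r)) L z).toReal) := by
  have hC : ContDiff ℝ 2 (fun x : Space => (ENNReal.ofReal (h ‖x‖)).toReal) := by
    simp_rw [ENNReal.toReal_ofReal (h0 _)]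
    exact hh
  exact contDiff_toReal_periodizedPotential (profile_range hsupp) hδL hL hC

/-- The kernel is `Lℤ³`-periodic. [folklore] -/
theorem kernel_periodic (L : ℝ) (h : ℝ → ℝ) (z : Space) (q : Fin 3 → ℤ) :
    (periodizedPotential (fun r => ENNReal.ofReal (h r)) L (z + latticeVec L q)).toReal =
      (periodizedPotential (fun r => ENNReal.ofReal (h r)) L z).toReal := by
  rw [periodizedPotential_add_latticeVec]

/-- The periodised bump is at most `1` (at most one lattice image contributes). [folklore] -/
theorem periodizedProfile_le_one (hL : 0 < L) (hδL : 2 * δ < L) (h1 : ∀ r, h r ≤ 1)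
    (hsupp : ∀ r, δ ≤ |r| → h r = 0) (z : Space) :
    periodizedPotential (fun r => ENNReal.ofReal (h r)) L z ≤ 1 := by
  rcases periodizedPotential_eq_zero_or_exists (profile_range hsupp) hδL hL z with h0 | ⟨q, _, hq⟩
  · rw [h0]; exact bot_le
  · rw [hq, ← ENNReal.ofReal_one]
    exact ENNReal.ofReal_le_ofReal (h1 _)

/-- `0 ≤ k`. [folklore] -/
theorem kernel_nonneg (L : ℝ) (h : ℝ → ℝ) (z : Space) :
    0 ≤ (periodizedPotential (fun r => ENNReal.ofReal (h r)) L z).toReal := ENNReal.toReal_nonneg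

/-- `k ≤ 1`. [folklore] -/
theorem kernel_le_one (hL : 0 < L) (hδL : 2 * δ < L) (h1 : ∀ r, h r ≤ 1)
    (hsupp : ∀ r, δ ≤ |r| → h r = 0) (z : Space) :
    (periodizedPotential (fun r => ENNReal.ofReal (h r)) L z).toReal ≤ 1 := by
  have := ENNReal.toReal_mono ENNReal.one_ne_top (periodizedProfile_le_one hL hδL h1 hsupp z)
  rwa [ENNReal.toReal_one] at this

/-- **Flat top**: if `z` is within `δ/2` of `t` modulo the lattice then `k(z − t) ≥ 1`. [folklore] -/
theorem kernel_flatTop (hL : 0 < L) (hδL : 2 * δ < L) (h1 : ∀ r, h r ≤ 1)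
    (hflat : ∀ r, |r| ≤ δ / 2 → h r = 1) (hsupp : ∀ r, δ ≤ |r| → h r = 0)
    {z t : Space} {q : Fin 3 → ℤ} (hq : ‖z - latticeVec L q - t‖ ≤ δ / 2) :
    1 ≤ (periodizedPotential (fun r => ENNReal.ofReal (h r)) L (z - t)).toReal := by
  have hterm : ENNReal.ofReal (h ‖z - t - latticeVec L q‖) = 1 := by
    rw [show z - t - latticeVec L q = z - latticeVec L q - t by abel,
      hflat _ (by rwa [abs_of_nonneg (norm_nonneg _)]), ENNReal.ofReal_one]
  have hge : 1 ≤ periodizedPotential (fun r => ENNReal.ofReal (h r)) L (z - t) := by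
    rw [← hterm]
    exact ENNReal.le_tsum q
  have := ENNReal.toReal_mono (ne_top_of_le_ne_top ENNReal.one_ne_top
    (periodizedProfile_le_one hL hδL h1 hsupp _)) hge
  rwa [ENNReal.toReal_one] at this

/-- **Support**: if `k(z − y) ≠ 0` then some lattice image of `z` is within `δ` of `y`. [folklore] -/
theorem kernel_support (hsupp : ∀ r, δ ≤ |r| → h r = 0) {z y : Space}
    (hk : (periodizedPotential (fun r => ENNReal.ofReal (h r)) L (z - y)).toReal ≠ 0) :
    ∃ q : Fin 3 → ℤ, ‖z - latticeVec L q - y‖ < δ := by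
  have hne : periodizedPotential (fun r => ENNReal.ofReal (h r)) L (z - y) ≠ 0 := fun h0 => by
    rw [h0, ENNReal.toReal_zero] at hk
    exact hk rfl
  by_contra hall
  push Not at hall
  apply hne
  refine ENNReal.tsum_eq_zero.2 fun q => ?_
  show ENNReal.ofReal (h ‖z - y - latticeVec L q‖) = 0
  rw [show z - y - latticeVec L q = z - latticeVec L q - y by abel,
    hsupp _ ((hall q).trans (le_abs_self _)), ENNReal.ofReal_zero]

/-- **Uniform bounds on `k, Dk, D²k`.** Locally `k` is a translate of the compactly supported `C²` function
`x ↦ h(|x|)`, whose derivatives up to order two are bounded. [folklore] -/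
theorem kernel_bounds (hL : 0 < L) (hδL : 2 * δ < L)
    (hh : ContDiff ℝ 2 (fun x : Space => h ‖x‖)) (h0 : ∀ r, 0 ≤ h r) (h1 : ∀ r, h r ≤ 1)
    (hsupp : ∀ r, δ ≤ |r| → h r = 0) :
    ∃ B : ℝ, (∀ z, |(periodizedPotential (fun r => ENNReal.ofReal (h r)) L z).toReal| ≤ B) ∧
      (∀ z, ‖fderiv ℝ (fun z : Space => (periodizedPotential (fun r => ENNReal.ofReal (h r)) L z).toReal) z‖ ≤ B) ∧
      ∀ z, ‖iteratedFDeriv ℝ 2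
        (fun z : Space => (periodizedPotential (fun r => ENNReal.ofReal (h r)) L z).toReal) z‖ ≤ B := by
  set η : Space → ℝ := fun x => h ‖x‖ with hη
  set k : Space → ℝ := fun z => (periodizedPotential (fun r => ENNReal.ofReal (h r)) L z).toReal with hk
  have hηs : HasCompactSupport η := by
    refine HasCompactSupport.intro (isCompact_closedBall (0 : Space) δ) fun x hx => ?_
    have hx' : δ ≤ |‖x‖| := by
      rw [abs_of_nonneg (norm_nonneg _)]
      rw [mem_closedBall, dist_zero_right] at hx
      exact (not_le.1 hx).le
    exact hsupp _ hx'
  obtain ⟨B₁, hB₁⟩ := (hηs.fderiv (𝕜 := ℝ)).exists_bound_of_continuous (hh.continuous_fderiv two_ne_zero)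
  obtain ⟨B₂, hB₂⟩ := (hηs.iteratedFDeriv (𝕜 := ℝ) 2).exists_bound_of_continuous
    (hh.continuous_iteratedFDeriv le_rfl)
  -- the local single-image representation of `k`
  have hloc : ∀ z : Space, ∃ n₀ : Fin 3 → ℤ, k =ᶠ[𝓝 z] fun x => η (x - latticeVec L n₀) := by
    intro z
    obtain ⟨n₀, hn₀⟩ := eventually_periodizedPotential_eq_single (profile_range hsupp) hδL hL z
    refine ⟨n₀, ?_⟩
    filter_upwards [hn₀] with x hx
    simp only [hk, hx, hη, ENNReal.toReal_ofReal (h0 _)]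
  refine ⟨max 1 (max B₁ B₂), fun z => ?_, fun z => ?_, fun z => ?_⟩
  · rw [abs_of_nonneg (kernel_nonneg L h z)]
    exact (kernel_le_one hL hδL h1 hsupp z).trans (le_max_left _ _)
  · obtain ⟨n₀, hn₀⟩ := hloc z
    rw [hn₀.fderiv_eq, show (fun x => η (x - latticeVec L n₀)) = fun x => η (x + -latticeVec L n₀) from
      funext fun x => by rw [sub_eq_add_neg], fderiv_comp_add_right]
    exact (hB₁ _).trans ((le_max_left _ _).trans (le_max_right _ _))
  · obtain ⟨n₀, hn₀⟩ := hloc z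
    rw [(hn₀.iteratedFDeriv ℝ 2).eq_of_nhds, iteratedFDeriv_comp_sub]
    exact (hB₂ _).trans ((le_max_right _ _).trans (le_max_right _ _))

end Kernel

/-- The Laplacian commutes with translations: `Δ(k(· − y))(z) = (Δk)(z − y)`. [folklore] -/
theorem laplacian_comp_sub (k : Space → ℝ) (y z : Space) :
    (Δ (fun x => k (x - y))) z = (Δ k) (z - y) := by
  rw [InnerProductSpace.laplacian_eq_iteratedFDeriv_orthonormalBasis (fun x => k (x - y))
      (EuclideanSpace.basisFun (Fin 3) ℝ),
    InnerProductSpace.laplacian_eq_iteratedFDeriv_orthonormalBasis k (EuclideanSpace.basisFun (Fin 3) ℝ)]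
  simp only [iteratedFDeriv_comp_sub]

/-! ## Pair relabelling -/

/-- **Bose symmetry of pair observables**: for a Bose-symmetric periodic state of `n+2` particles and every
pair `i < j`, `∫ F(xᵢ − xⱼ)|Ψ|² = ∫ F(x₀ − x₁)|Ψ|²` on the cell (relabel by `σ = (0 i)(1 j)`,
`setLIntegral_cellN_comp_perm`). [folklore] -/
theorem lintegral_pair_eq_pair01 {n : ℕ} {L : ℝ} (Ψ : PeriodicTrialState (n + 2) L) (F : Space → ℝ≥0∞)
    {i j : Fin (n + 2)} (hij : i < j) :
    ∫⁻ X in cellN (n + 2) L, F (X i - X j) * (‖Ψ.ψ X‖₊ : ℝ≥0∞) ^ 2 =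
      ∫⁻ X in cellN (n + 2) L, F (X 0 - X 1) * (‖Ψ.ψ X‖₊ : ℝ≥0∞) ^ 2 := by
  have hj0 : j ≠ 0 := fun h => by
    rw [h] at hij
    exact (Fin.not_lt_zero i) hij
  have hji : j ≠ i := hij.ne'
  set σ : Equiv.Perm (Fin (n + 2)) := Equiv.swap 0 i * Equiv.swap 1 j with hσ
  have hσ0 : σ 0 = i := by
    rw [hσ, Equiv.Perm.mul_apply, Equiv.swap_apply_of_ne_of_ne (by simp) hj0.symm, Equiv.swap_apply_left]
  have hσ1 : σ 1 = j := by
    rw [hσ, Equiv.Perm.mul_apply, Equiv.swap_apply_left, Equiv.swap_apply_of_ne_of_ne hj0 hji]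
  have key := setLIntegral_cellN_comp_perm (L := L) σ (fun Y => F (Y 0 - Y 1) * (‖Ψ.ψ Y‖₊ : ℝ≥0∞) ^ 2)
  simp only [Function.comp_apply, hσ0, hσ1] at key
  rw [← key]
  refine lintegral_congr fun X => ?_
  rw [Ψ.symm σ X]

end PuffFloorInnerPairCount

open PuffFloorInnerPairCount in
/-- **Registered helper `puffFloor_pairRelabelling`** (sub-goal of stmt-AtomisticToContinuum-11785 for the kernel tools of
stub S7in): Bose symmetry of pair observables, `∫F(xᵢ−xⱼ)|Ψ|² = ∫F(x₀−x₁)|Ψ|²` —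
`PuffFloorInnerPairCount.lintegral_pair_eq_pair01`. Folklore. -/
theorem puffFloor_pairRelabelling :
    ∀ (n : ℕ) (L : ℝ) (Ψ : PeriodicTrialState (n + 2) L) (F : Space → ℝ≥0∞) (i j : Fin (n + 2)), i < j →
      ∫⁻ X in cellN (n + 2) L, F (X i - X j) * (‖Ψ.ψ X‖₊ : ℝ≥0∞) ^ 2 =
        ∫⁻ X in cellN (n + 2) L, F (X 0 - X 1) * (‖Ψ.ψ X‖₊ : ℝ≥0∞) ^ 2 :=
  fun _n _L Ψ F _i _j hij => lintegral_pair_eq_pair01 Ψ F hij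

end Summit.AtomisticToContinuum.BoseEinsteinCondensation.Theorems

end
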